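import Literature.Analysis.FluidPDE.HardSphereAlexander
import HarnessLib

/-!
# Counting the collisions of the hard-sphere flow on the torus window by window

Bookkeeping layer for the collision intensity bound (`HardSphereCollisionIntensity`): the window
iteration of Gallagher–Saint-Raymond–Texier 2013, proof of Prop. 4.1.1 (formalised in
`HardSphereShortTime`, `HardSphereScattering`, `HardSphereAlexander` for the *bad set*), run for
the *number* of collisions `Alexander.collisionCount` of the collision-by-collision flow
`Alexander.fwdFlow` on `(T^d × ℝ^d)^N`. With window `δ` and interaction length `r = 2Vδ` on the
energy shell `E ≤ V²/2`:

* `collisionCount_le_of_lt_collisionInstant`, `collisionCount_add_le_of_lt_collisionInstant_fwdFlow`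
  — counting collisions from the instants, before and across a restart
  (`collisionInstant_fwdFlow_succ_add`);
* `ofReal_lt_collisionInstant_two_of_mem_shortGood` — on the short-time good set at most one
  collision happens in the window; `ofReal_lt_collisionInstant_one_of_mem_shortGood` — none unless
  the datum lies in a hit piece; `freeExitTime_pos_of_mem_shortGood`; a hit piece lies in the thin
  shell `closePair` of its pair (`hitPiece_subset_closePair`);
* `collisionCount_le_sum_indicator_of_mem_iterGood` — on the survivors `iterGood m` the number of
  collisions in `[0, (m+1)δ]` is at most the number of window-starts `wδ` at which the orbit lies
  in any set `H` containing the hit pieces;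
* `volume_iterGood_inter_preimage_windowStart_le` — the survivors whose orbit lies in a
  measurable `B` at a window-start have volume `≤ vol B` (`volume_iterGood_inter_preimage_le`);
  `iterGood_antitone`, `measurableSet_iterGood`.

## References

* I. Gallagher, L. Saint-Raymond, B. Texier, *From Newton to Boltzmann: hard spheres and
  short-range potentials*, EMS (2013), arXiv:1208.5753, §4.1, proof of Prop. 4.1.1 (p. 19).
* C. Cercignani, R. Illner, M. Pulvirenti, *The Mathematical Theory of Dilute Gases*, Springer
  (1994), §4.2, App. 4.A pp. 107–111.
-/

open Set Filter Topology Function MeasureTheory Metric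
open scoped ENNReal

namespace Literature.Analysis.FluidPDE

noncomputable section

section Kinetic

namespace Alexander

variable {d : Type*} [Fintype d] {N : ℕ}

/-! ## Counting collisions from the instants -/

section Count

variable {X : Type*} {G : Geometry d X} {ε : ℝ}

/-- If the `(j+1)`-st instant is beyond `u` then at most `j` collisions are counted in `[0, u]`
(monotonicity of the instants only). [folklore] -/
theorem collisionCount_le_of_lt_collisionInstant {y : Config N d X} {u : ℝ} {j : ℕ}
    (hj : ENNReal.ofReal u < collisionInstant G ε y (j + 1)) : collisionCount G ε y u ≤ j := by
  refine csSup_le' fun k' hk' => ?_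
  by_contra hlt
  exact (not_le.2 hj) ((monotone_collisionInstant y (by omega : j + 1 ≤ k')).trans hk')

/-- **Counting across a restart**: if `t_k ≤ s < t_{k+1}` and the `(j+1)`-st instant of the
restarted datum `Φ_s z` is beyond `u ≥ 0`, then at most `k + j` collisions of `z` are counted in
`[0, s + u]` (`collisionInstant_fwdFlow_succ_add`: the instants of `Φ_s z` are those of `z`
shifted by `s`). [folklore] -/
theorem collisionCount_add_le_of_lt_collisionInstant_fwdFlow {z : Config N d X} {s u : ℝ}
    {k j : ℕ} (hs : 0 ≤ s) (hu : 0 ≤ u)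
    (h1 : collisionInstant G ε z k ≤ ENNReal.ofReal s)
    (h2 : ENNReal.ofReal s < collisionInstant G ε z (k + 1))
    (hj : ENNReal.ofReal u < collisionInstant G ε (fwdFlow G ε z s) (j + 1)) :
    collisionCount G ε z (s + u) ≤ k + j := by
  have hinst := collisionInstant_fwdFlow_succ_add (G := G) (ε := ε) hs h1 h2 j
  have hgt : ENNReal.ofReal (s + u) < collisionInstant G ε z (k + j + 1) := by
    rw [show k + j + 1 = k + (j + 1) by omega, ← hinst, ENNReal.ofReal_add hs hu,
      add_comm (ENNReal.ofReal s)]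
    exact ENNReal.add_lt_add_right ENNReal.ofReal_ne_top hj
  exact collisionCount_le_of_lt_collisionInstant hgt

end Count

/-! ## One window from a short-time good datum -/

section Window

variable {ε r δ V : ℝ} {y : Config N d (UnitAddTorus d)}

/-- **At most one collision in the window**: on the short-time good set of the energy shell
(`2Vδ ≤ r`, `ε + 2r < 1/2`) the second collision instant is beyond `δ`. [cite: GST2013, proof of Prop. 4.1.1 p. 19] -/
theorem ofReal_lt_collisionInstant_two_of_mem_shortGood (hε : 0 < ε) (hεr : ε + 2 * r < 2⁻¹)
    (hr : 2 * V * δ ≤ r) (hV0 : 0 ≤ V) (hδ : 0 ≤ δ) (hE : configEnergy y ≤ V ^ 2 / 2)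
    (hy : y ∈ shortGood N ε r δ) :
    ENNReal.ofReal δ < collisionInstant (Torus.geometry d) ε y 2 := by
  have hV : ∀ i, ‖(y i).2‖ ≤ V := norm_vel_le_of_configEnergy_le hV0 hE
  have hr0 : 0 ≤ r := le_trans (by positivity) hr
  have hε' : ε < 2⁻¹ := by linarith
  have h12 : collisionInstant (Torus.geometry d) ε y 1 ≤ collisionInstant (Torus.geometry d) ε y 2 :=
    monotone_collisionInstant y (by norm_num)
  rw [collisionInstant_one] at h12
  rcases mem_shortGood.1 hy with h | ⟨p, hp, h | h⟩
  · exact (ofReal_lt_freeExitTime_of_forall_lt_norm hε' hδ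
      (forall_lt_norm_of_mem_farSet hV hr h)).trans_le h12
  · exact (ofReal_lt_freeExitTime_of_forall_lt_norm hε' hδ
      (forall_lt_norm_of_mem_noHitPiece hε hV hr hεr h)).trans_le h12
  · exact (HitHyp.mk hε hεr hr hV0 hE hp h).ofReal_lt_collisionInstant_two

/-- **No collision in the window off the hit pieces**: on the short-time good set of the energy
shell, a datum in no hit piece has its first collision instant beyond `δ`. [cite: GST2013, proof of Prop. 4.1.1 p. 19] -/
theorem ofReal_lt_collisionInstant_one_of_mem_shortGood (hε : 0 < ε) (hεr : ε + 2 * r < 2⁻¹)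
    (hr : 2 * V * δ ≤ r) (hV0 : 0 ≤ V) (hδ : 0 ≤ δ) (hE : configEnergy y ≤ V ^ 2 / 2)
    (hy : y ∈ shortGood N ε r δ)
    (hnot : ∀ p : Fin N × Fin N, p.1 < p.2 → y ∉ hitPiece N ε r δ p.1 p.2) :
    ENNReal.ofReal δ < collisionInstant (Torus.geometry d) ε y 1 := by
  have hV : ∀ i, ‖(y i).2‖ ≤ V := norm_vel_le_of_configEnergy_le hV0 hE
  have hr0 : 0 ≤ r := le_trans (by positivity) hr
  have hε' : ε < 2⁻¹ := by linarith
  rw [collisionInstant_one]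
  rcases mem_shortGood.1 hy with h | ⟨p, hp, h | h⟩
  · exact ofReal_lt_freeExitTime_of_forall_lt_norm hε' hδ (forall_lt_norm_of_mem_farSet hV hr h)
  · exact ofReal_lt_freeExitTime_of_forall_lt_norm hε' hδ
      (forall_lt_norm_of_mem_noHitPiece hε hV hr hεr h)
  · exact (hnot p hp h).elim

/-- On the short-time good set of the energy shell the first exit time is positive (no contact at
time `0`). [folklore] -/
theorem freeExitTime_pos_of_mem_shortGood (hε : 0 < ε) (hεr : ε + 2 * r < 2⁻¹)
    (hr : 2 * V * δ ≤ r) (hV0 : 0 ≤ V) (hδ : 0 ≤ δ) (hE : configEnergy y ≤ V ^ 2 / 2)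
    (hy : y ∈ shortGood N ε r δ) :
    0 < freeExitTime (Torus.geometry d) ε y := by
  have hV : ∀ i, ‖(y i).2‖ ≤ V := norm_vel_le_of_configEnergy_le hV0 hE
  have hr0 : 0 ≤ r := le_trans (by positivity) hr
  have hε' : ε < 2⁻¹ := by linarith
  rcases mem_shortGood.1 hy with h | ⟨p, hp, h | h⟩
  · exact bot_le.trans_lt (ofReal_lt_freeExitTime_of_forall_lt_norm hε' hδ
      (forall_lt_norm_of_mem_farSet hV hr h))
  · exact bot_le.trans_lt (ofReal_lt_freeExitTime_of_forall_lt_norm hε' hδ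
      (forall_lt_norm_of_mem_noHitPiece hε hV hr hεr h))
  · have hh := HitHyp.mk hε hεr hr hV0 hE hp h
    rw [hh.freeExitTime_eq, ENNReal.ofReal_pos]
    exact hh.hitTime_pos

/-- A hit piece lies in the thin shell `closePair` of its pair (`ε < ‖q‖ ≤ ε + r`). [folklore] -/
theorem hitPiece_subset_closePair (ε r δ : ℝ) (i j : Fin N) :
    hitPiece (d := d) N ε r δ i j ⊆ closePair N d ε r i j :=
  fun _ hz => ⟨le_of_lt hz.2.2.1.1, hz.2.1⟩

end Window

/-! ## Counting collisions on the survivors of the iteration -/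

section Iteration

variable {ε δ V : ℝ}

/-- `iterGood` decreases with the number of iterations. [folklore] -/
theorem iterGood_antitone : Antitone (iterGood (d := d) N ε δ V) :=
  antitone_nat_of_succ_le iterGood_succ_subset

/-- `iterGood m` is measurable. [folklore] -/
theorem measurableSet_iterGood (hε' : ε < 2⁻¹) (δ V : ℝ) (m : ℕ) :
    MeasurableSet (iterGood (d := d) N ε δ V m) := by
  have hG := Torus.isHardSphereRegular_geometry (d := d) hε'
  have hGm : (Torus.geometry d).IsMeasurable := Torus.isMeasurable_geometry
  have h : iterGood (d := d) N ε δ V m = {z | configEnergy z ≤ V ^ 2 / 2} ∩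
      (shortGood N ε (2 * V * δ) δ ∩ ⋂ (k : ℕ) (_ : k < m),
        (fun z => fwdFlow (Torus.geometry d) ε z (((k : ℝ) + 1) * δ)) ⁻¹'
          shortGood N ε (2 * V * δ) δ) := by
    ext z
    simp only [iterGood, mem_setOf_eq, mem_inter_iff, mem_iInter, mem_preimage]
  rw [h]
  exact (measurableSet_energyShell _).inter ((measurableSet_shortGood ε _ δ).inter
    (MeasurableSet.iInter fun k => MeasurableSet.iInter fun _ =>
      measurable_fwdFlow hG hGm _ (measurableSet_shortGood ε _ δ)))

/-- **The count of collisions on the survivors**: for `z ∈ iterGood m` and any set `H` containing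
the hit pieces (window `δ`, interaction length `2Vδ`), the number of collisions in
`[0, (m+1)δ]` is at most the number of window-starts `wδ`, `w ≤ m`, at which the orbit lies in
`H` (at most one collision per window, and none off the hit pieces; restart). [cite: GST2013, proof of Prop. 4.1.1 p. 19] -/
theorem collisionCount_le_sum_indicator_of_mem_iterGood (hε : 0 < ε)
    (hch : ε + 2 * (2 * V * δ) < 2⁻¹) (hV0 : 0 ≤ V) (hδ : 0 ≤ δ)
    {H : Set (Config N d (UnitAddTorus d))}
    (hH : ∀ p : Fin N × Fin N, p.1 < p.2 → hitPiece N ε (2 * V * δ) δ p.1 p.2 ⊆ H) (m : ℕ)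
    {z : Config N d (UnitAddTorus d)} (hz : z ∈ iterGood N ε δ V m) :
    (collisionCount (Torus.geometry d) ε z (((m : ℝ) + 1) * δ) : ℝ≥0∞) ≤
      ∑ w ∈ Finset.range (m + 1),
        H.indicator (fun _ => (1 : ℝ≥0∞)) (fwdFlow (Torus.geometry d) ε z ((w : ℝ) * δ)) := by
  induction m generalizing z with
  | zero =>
    have hE := hz.1
    have hsg := hz.2.1
    simp only [Nat.cast_zero, zero_add, one_mul, Finset.range_one, Finset.sum_singleton, zero_mul]
    rw [fwdFlow_zero_of_pos (freeExitTime_pos_of_mem_shortGood hε hch le_rfl hV0 hδ hE hsg)]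
    by_cases hhit : ∃ p : Fin N × Fin N, p.1 < p.2 ∧ z ∈ hitPiece N ε (2 * V * δ) δ p.1 p.2
    · obtain ⟨p, hp, hzp⟩ := hhit
      rw [indicator_of_mem (hH p hp hzp)]
      have h1 := collisionCount_le_of_lt_collisionInstant
        (ofReal_lt_collisionInstant_two_of_mem_shortGood hε hch le_rfl hV0 hδ hE hsg)
      exact_mod_cast h1
    · push Not at hhit
      have h0 := collisionCount_le_of_lt_collisionInstant (j := 0)
        (ofReal_lt_collisionInstant_one_of_mem_shortGood hε hch le_rfl hV0 hδ hE hsg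
          fun p hp => hhit p hp)
      rw [Nat.le_zero.1 h0, Nat.cast_zero]
      exact bot_le
  | succ m ih =>
    have hz' : z ∈ iterGood N ε δ V m := iterGood_succ_subset m hz
    have IH := ih hz'
    set s : ℝ := ((m : ℝ) + 1) * δ with hs_def
    have hs0 : 0 ≤ s := by positivity
    have hy : fwdFlow (Torus.geometry d) ε z s ∈ shortGood N ε (2 * V * δ) δ :=
      hz.2.2 m (Nat.lt_succ_self m)
    have hEy : configEnergy (fwdFlow (Torus.geometry d) ε z s) ≤ V ^ 2 / 2 := by
      rw [configEnergy_fwdFlow]; exact hz.1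
    have hreg := fwdGoodUpTo_of_mem_iterGood hε hch hV0 hδ m hz'
    obtain ⟨k, h1, h2⟩ := hreg.exists_segment le_rfl
    have hk : collisionCount (Torus.geometry d) ε z s = k := collisionCount_eq_of_segment h1 h2
    have hcast : (((m + 1 : ℕ) : ℝ) + 1) * δ = s + δ := by rw [hs_def]; push_cast; ring
    have hcast2 : ((m + 1 : ℕ) : ℝ) * δ = s := by rw [hs_def]; push_cast; ring
    rw [hcast, Finset.sum_range_succ, hcast2]
    by_cases hhit : ∃ p : Fin N × Fin N, p.1 < p.2 ∧
        fwdFlow (Torus.geometry d) ε z s ∈ hitPiece N ε (2 * V * δ) δ p.1 p.2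
    · obtain ⟨p, hp, hyp⟩ := hhit
      rw [indicator_of_mem (hH p hp hyp)]
      have hj := ofReal_lt_collisionInstant_two_of_mem_shortGood hε hch le_rfl hV0 hδ hEy hy
      have hc : collisionCount (Torus.geometry d) ε z (s + δ) ≤ k + 1 :=
        collisionCount_add_le_of_lt_collisionInstant_fwdFlow hs0 hδ h1 h2 hj
      calc (collisionCount (Torus.geometry d) ε z (s + δ) : ℝ≥0∞) ≤ (k : ℝ≥0∞) + 1 := by
            exact_mod_cast hc
        _ = (collisionCount (Torus.geometry d) ε z s : ℝ≥0∞) + 1 := by rw [hk]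
        _ ≤ _ := add_le_add IH le_rfl
    · push Not at hhit
      have hj := ofReal_lt_collisionInstant_one_of_mem_shortGood hε hch le_rfl hV0 hδ hEy hy
        fun p hp => hhit p hp
      have hc : collisionCount (Torus.geometry d) ε z (s + δ) ≤ k + 0 :=
        collisionCount_add_le_of_lt_collisionInstant_fwdFlow hs0 hδ h1 h2 hj
      calc (collisionCount (Torus.geometry d) ε z (s + δ) : ℝ≥0∞) ≤ (k : ℝ≥0∞) := by
            exact_mod_cast hc
        _ = (collisionCount (Torus.geometry d) ε z s : ℝ≥0∞) := by rw [hk]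
        _ ≤ _ := IH
        _ ≤ _ := le_self_add

/-- **The survivors whose orbit lies in `B` at a window-start have volume at most `vol B`**
(`volume_iterGood_inter_preimage_le` at the previous window; at `w = 0` the flow is the
identity on the survivors). [folklore] -/
theorem volume_iterGood_inter_preimage_windowStart_le (hε : 0 < ε)
    (hch : ε + 2 * (2 * V * δ) < 2⁻¹) (hV0 : 0 ≤ V) (hδ : 0 ≤ δ) {m w : ℕ} (hw : w ≤ m)
    {B : Set (Config N d (UnitAddTorus d))} (hB : MeasurableSet B) :
    volume {z | z ∈ iterGood N ε δ V m ∧ fwdFlow (Torus.geometry d) ε z ((w : ℝ) * δ) ∈ B} ≤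
      volume B := by
  cases w with
  | zero =>
    refine measure_mono fun z hz => ?_
    have h := hz.2
    rwa [Nat.cast_zero, zero_mul, fwdFlow_zero_of_pos
      (freeExitTime_pos_of_mem_shortGood hε hch le_rfl hV0 hδ hz.1.1 hz.1.2.1)] at h
  | succ w =>
    refine le_trans (measure_mono fun z hz => ?_)
      (volume_iterGood_inter_preimage_le hε hch hV0 hδ w hB)
    refine ⟨iterGood_antitone (by omega : w ≤ m) hz.1, ?_⟩
    have h := hz.2
    have hcast : ((w + 1 : ℕ) : ℝ) * δ = ((w : ℝ) + 1) * δ := by push_cast; ring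
    rwa [hcast] at h

end Iteration

end Alexander

end Kinetic

end

end Literature.Analysis.FluidPDE
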